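import Literature.MathematicalPhysics.QuantumFieldTheory.King1986.AliasSums
import Literature.MathematicalPhysics.QuantumFieldTheory.King1986.AveragingWeightRate
import Literature.MathematicalPhysics.QuantumFieldTheory.King1986.EffectiveLaplacianRate
import HarnessLib

/-!
# King 1986, Proposition 3.8 (3.71), momentum-space core I: the MODES of (4.2)/(4.19), the factor bounds
# (4.20)–(4.21) in kernel form, and the far aliases `m ≠ 0` — (4.23) `≦ CL^{−γk}`

**Citation header (reproduction of PUBLISHED and PROVED work; seat `pub-ymgap-dag-n18-b` of the cell `pub-ymgap`,
Track-A node N18 = NE5, whose PRINTED MODEL of record is King's Prop. 3.8/3.9 — p. 665: «If we replace such a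
propagator in E_φ^{(k+n)}(H̃), the error is the same graph with a difference of propagators on one line. Using the
method presented, this error is bounded, and Proposition 3.8 gives the desired factor L^{−γk}.»; FIRST of two files
(sequel `King1986/MinimizerAliasRate`: the near aliases, the assembly, King's symbols); companion of the template modules
`King1986/AveragingWeightRate` ((4.3), Lemma 4.4), `King1986/AliasSums` ((4.22)), `King1986/EffectiveLaplacianRate` ((4.4),
(4.7)), whose headers list «(4.19)–(4.21) themselves (the Fourier representation and the factor bounds), the p′-integral
and the L^{−γk} extraction of (4.23)» and «the assembly of Proposition 3.8 (3.71)» as NOT COVERED).**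
C. King, *The U(1) Higgs model. I. The continuum limit*, Commun. Math. Phys. **102** (1986) 649–677 [King1986], §3.4
Proposition 3.8 (3.71) p. 664 and §4 pp. 670–672: (4.1)–(4.5), (4.19)–(4.23).  Page images READ AS IMAGES by this seat:
`b2b-balaban-template/king-renders/1986-cmp102-king-u1-higgs-I-p016-x2.png` (p. 664), `…-p017-x2.png` (p. 665),
`…-p022-x2.png` (p. 670), `…-p024-x2.png` (p. 672).  King's paper is TEMPLATE LITERATURE (a printed and proved `A = 0`
mechanism, abelian Higgs, `d = 2, 3`), not a manuscript under audit; nothing here is about Bałaban's papers.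

**What King prints (verbatim).**  p. 670: «(a_kG_kQ^*_k)(x, y) = (2π)^{−d} ∫_{|p′|≦π} dp′ Δ^{(k)}(p′) Σ_l e^{i(p′+l)(x−y)}
u^η_k(p′+l)/Δ^η(p′+l), (4.2) where x ∈ ηZ^d, y ∈ Z^d, p′ ∈ [−π, π), l ∈ 2πZ^d and −π(L^k − 1) ≦ l_μ ≦ π(L^k − 1) for L
odd», «u^η_k(p) = Π_{μ=1}^d [(e^{−ip_μ} − 1)η(e^{−iηp_μ} − 1)^{−1}], (4.3)  Δ^η(p) = 4η^{−2} Σ_{μ=1}^d sin²(1/2ηp_μ) +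
m²(L^kε)², (4.4)».  p. 672: «where l ∈ 2πZ^d is the same as in (4.2). Also m ∈ 2πL^kZ^d and |m_μ| ≦ πL^k(L^n − 1) for L
odd … We have the following bounds: |u^{η′}_{k+n}(p′+l+m)| < C Π_{μ=1}^d |p′_μ||(p′+l+m)_μ|^{−1}, (4.20)
|Δ^{(k+n)}(p′)Δ^{η′}(p′+l+m)^{−1}| ≦ C|p′|²|p′+l+m|^{−2}. (4.21) … so the sum over l, m is bounded by
Σ_{l,m} |p′+l+m|^{α−1} Π_μ |(p′+l+m)_μ|^{−1} ≦ C for α < 1. (4.22)  We first bound the terms in (4.19) with m ≠ 0 as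
follows: |(4.19); m ≠ 0| ≦ C(2π)^{−d}∫dp′ Σ_{m≠0}Σ_l |p′+l+m|^{α−1}|p′|² Π_μ |p′_μ||(p′+l+m)_μ|^{−1}
≦ CL^{−γk}(2π)^{−d}∫dp′ Σ_{m≠0}Σ_l |p′+l+m|^{α−1+γ}|p′|² Π_μ |p′_μ||(p′+l+m)_μ|^{−1} ≦ CL^{−γk} for α + γ < 1. (4.23)».

**What this file PROVES (kernel; Mathlib + the named tree modules; NO `def … : Prop`, no named fact).**  In King's
momentum variables — reduced momentum `p′ : Fin d → ℝ` with `|p′_μ| ≤ π`, aliases `q = p′ + 2πk` (`AliasSums.aliasPt`),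
spacing `η > 0` with the zone condition `|ηq_μ| ≤ π`, `u^η = uWeight η` ((4.3), `AveragingWeightRate`),
`Δ^η = latticeSymbol η M` ((4.4), `EffectiveLaplacianRate`; ANY mass `M ≥ 0`):
* §1 **(4.20) in kernel form** `‖u^η(p′+2πk)‖ ≤ (π/2)^d·aliasWeight p′ k` (`norm_uWeight_alias_le`; per coordinate
  `|e^{−iq} − 1| = |e^{−ip′} − 1| ≤ |p′|`, `|D_η(q)| ≥ (2/π)|q|`, `norm_uFac_alias_le`), the uniform `‖u^η(q)‖ ≤ (π/2)^d`
  (`norm_uWeight_le`), and **(4.21)'s denominator** `Δ^η(q)⁻¹ ≤ (π²/4)‖q‖^{−2}` (`inv_latticeSymbol_le`, Jordan; sup norm).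
  (The numerator `|p′|²` of (4.21) — `Δ^{(k)}(p′) ≤ C|p′|²` — is NOT used: the sequel bounds `Δ^{(k+n)}` by `a_{k+n}` off
  the central alias and by `(π²/4)^dΔ^η(p′)` on it, which keeps every constant mass-uniform.)
* §2 the MODES of (4.2)/(4.19): `modeTerm Δ η M q ξ = Δ·u^η(q)·Δ^η(q)⁻¹·e^{iq·ξ}` (position `ξ` in unit-lattice
  coordinates, `Δ` the value of the effective symbol (4.5) at `p′` as a free real parameter), its size `modeAmp`, and
  **THE FAR ALIASES** ((4.23)): an alias at sup-distance `≥ N` from the origin (the `m ≠ 0` aliases of the finer lattice,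
  `|p′+l+m|_∞ ≥ πL^k`) has `Δ·Δ^{η′}(q)⁻¹‖u^{η′}(q)‖ ≤ a(π/2)^d(π²/4)·N^{−γ}·aliasTerm (γ−1) p′ k` for `0 ≤ Δ ≤ a`, `γ ≥ 0`
  (`modeAmp_far_le` — the trade `‖q‖^{−2} = ‖q‖^{−γ}‖q‖^{γ−2} ≤ N^{−γ}‖q‖^{γ−2}`), and over ANY finite family of such
  aliases `Σ ≤ a(π/2)^d(π²/4)·aliasConst d (γ−1)·N^{−γ}` (`sum_modeAmp_far_le`, by (4.22) = `alias_sum_le_of_subset`,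
  `γ < 2`, `d ≥ 1`) — King's «|(4.19); m ≠ 0| ≦ CL^{−γk}» at `N = L^k`, with an explicit constant, uniformly in `p′` and
  the mass.
* §3 the CONSTANTS of the sequel's bounds as closed expressions (`nearRateConst`, `nearPosConst`, `centralRateConst`,
  `centralPosConst`, `prop38RateConst`, `prop38PosConst`; `lemma43Const a L k n = 2a_k(a_n⁻¹ + π²/48 + 1/3)` = the
  constant of `CompositionLaw.lemma43_aK`).

**NOT COVERED here** (see the sequel): the near aliases `m = 0` ((4.24)–(4.31)), the assembled bound, King's symbols;
and, in neither file: (4.2)/(4.19) as an operator identity, the `p′`-integral, Theorem 3.3's decay factor, the Hölder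
and derivative lines of (3.71), even `L`, `A ≠ 0`.  HONEST FRAMING: King's `A = 0` scalar MODEL of the two-spacing
mechanism postulated (as the cell's NEW ESTIMATE NE5) for Bałaban's one-step outputs — template literature, finite
lattice momenta, nothing continuum / mass-gap / Clay; count-neutral for the cell's 27 nodes.
-/

noncomputable section

open Real Finset

namespace Literature.MathematicalPhysics.QuantumFieldTheory.King1986

/-! ## §1 The factor bounds (4.20)–(4.21) in kernel form -/

/-- One factor of the averaging weight is bounded by `π/2` on the zone `|ηx| ≤ π`:
`‖(e^{−ix} − 1)/D_η(x)‖ ≤ |x| / ((2/π)|x|)`. [cite: King1986, (4.20) p.672] -/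
theorem norm_uFac_le_half_pi {η x : ℝ} (hη : 0 < η) (hx : |η * x| ≤ π) : ‖uFac η x‖ ≤ π / 2 := by
  unfold uFac
  by_cases h0 : x = 0
  · rw [if_pos h0, norm_one]
    linarith [Real.pi_gt_three]
  · rw [if_neg h0, norm_div]
    have hden : 2 / π * |x| ≤ ‖fdq η x‖ := norm_fdq_ge hη hx
    have hxpos : 0 < |x| := abs_pos.mpr h0
    have hdenpos : 0 < ‖fdq η x‖ := lt_of_lt_of_le (by positivity) hden
    have hnum : ‖Complex.exp (Complex.I * ((-x : ℝ) : ℂ)) - 1‖ ≤ |x| := by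
      have h := norm_exp_I_sub_exp_I_le (-x) 0
      simp only [Complex.ofReal_zero, mul_zero, Complex.exp_zero, sub_zero, abs_neg] at h
      exact h
    rw [div_le_iff₀ hdenpos]
    calc ‖Complex.exp (Complex.I * ((-x : ℝ) : ℂ)) - 1‖ ≤ |x| := hnum
      _ = π / 2 * (2 / π * |x|) := by field_simp
      _ ≤ π / 2 * ‖fdq η x‖ := mul_le_mul_of_nonneg_left hden (by positivity)

/-- The numerator of an ALIAS factor only sees the reduced momentum: `e^{−i(p + 2πk)} = e^{−ip}` for an integer `k`.
[folklore] -/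
private theorem cexp_neg_alias (p : ℝ) (k : ℤ) :
    Complex.exp (Complex.I * ((-(p + 2 * π * k) : ℝ) : ℂ)) = Complex.exp (Complex.I * ((-p : ℝ) : ℂ)) := by
  have h : Complex.I * ((-(p + 2 * π * k) : ℝ) : ℂ)
      = Complex.I * ((-p : ℝ) : ℂ) + ((-k : ℤ) : ℂ) * (2 * π * Complex.I) := by
    push_cast; ring
  rw [h, Complex.exp_add, Complex.exp_int_mul_two_pi_mul_I, mul_one]

/-- **(4.20), one coordinate**: for a nonzero alias `k`, `‖f_η(p + 2πk)‖ ≤ (π/2)·|p|/|p + 2πk|` on the zone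
(`|p| ≤ π`, `|η(p + 2πk)| ≤ π`). [cite: King1986, (4.20) p.672] -/
theorem norm_uFac_alias_le {η p : ℝ} (hη : 0 < η) (hp : |p| ≤ π) {k : ℤ} (hk : k ≠ 0)
    (hz : |η * (p + 2 * π * k)| ≤ π) :
    ‖uFac η (p + 2 * π * k)‖ ≤ π / 2 * (|p| / |p + 2 * π * k|) := by
  have hq : π ≤ |p + 2 * π * k| := pi_le_abs_add hp hk
  have hqpos : 0 < |p + 2 * π * k| := lt_of_lt_of_le Real.pi_pos hq
  have hq0 : p + 2 * π * k ≠ 0 := abs_pos.mp hqpos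
  unfold uFac
  rw [if_neg hq0, norm_div, cexp_neg_alias]
  have hden : 2 / π * |p + 2 * π * k| ≤ ‖fdq η (p + 2 * π * k)‖ := norm_fdq_ge hη hz
  have hdenpos : 0 < ‖fdq η (p + 2 * π * k)‖ := lt_of_lt_of_le (by positivity) hden
  have hnum : ‖Complex.exp (Complex.I * ((-p : ℝ) : ℂ)) - 1‖ ≤ |p| := by
    have h := norm_exp_I_sub_exp_I_le (-p) 0
    simp only [Complex.ofReal_zero, mul_zero, Complex.exp_zero, sub_zero, abs_neg] at h
    exact h
  rw [div_le_iff₀ hdenpos]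
  calc ‖Complex.exp (Complex.I * ((-p : ℝ) : ℂ)) - 1‖ ≤ |p| := hnum
    _ = π / 2 * (|p| / |p + 2 * π * k|) * (2 / π * |p + 2 * π * k|) := by
        rw [show π / 2 * (|p| / |p + 2 * π * k|) * (2 / π * |p + 2 * π * k|)
            = |p| * (π / 2 * (2 / π)) * (|p + 2 * π * k| / |p + 2 * π * k|) by ring,
          div_self (ne_of_gt hqpos)]
        have : π / 2 * (2 / π) = 1 := by field_simp
        rw [this]; ring
    _ ≤ π / 2 * (|p| / |p + 2 * π * k|) * ‖fdq η (p + 2 * π * k)‖ :=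
        mul_le_mul_of_nonneg_left hden (by positivity)

/-- The weight `Π_μ [l_μ = 0 ? 1 : |p′_μ|/|(p′+l)_μ|]` of (4.20)/(4.22) is nonnegative. [cite: King1986, (4.22) p.672] -/
theorem aliasWeight_nonneg {d : ℕ} (p : Fin d → ℝ) (k : Fin d → ℤ) : 0 ≤ aliasWeight p k := by
  unfold aliasWeight
  exact Finset.prod_nonneg fun μ _ => by split_ifs <;> positivity

/-- **(4.20) in kernel form**: `‖u^η(p′ + 2πk)‖ ≤ (π/2)^d · Π_μ [k_μ = 0 ? 1 : |p′_μ|/|p′_μ + 2πk_μ|]`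
(= `(π/2)^d · aliasWeight p′ k`) for `|p′_μ| ≤ π` and the alias point in the zone `|η(p′+2πk)_μ| ≤ π`.
[cite: King1986, (4.20) p.672] -/
theorem norm_uWeight_alias_le {d : ℕ} {η : ℝ} (hη : 0 < η) {p : Fin d → ℝ} (hp : ∀ μ, |p μ| ≤ π)
    (k : Fin d → ℤ) (hz : ∀ μ, |η * aliasPt p k μ| ≤ π) :
    ‖uWeight η (aliasPt p k)‖ ≤ (π / 2) ^ d * aliasWeight p k := by
  rw [norm_uWeight]
  unfold aliasWeight
  have hconst : (π / 2) ^ d = ∏ _μ : Fin d, (π / 2 : ℝ) := by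
    rw [Finset.prod_const, Finset.card_univ, Fintype.card_fin]
  rw [hconst, ← Finset.prod_mul_distrib]
  refine Finset.prod_le_prod (fun μ _ => norm_nonneg _) fun μ _ => ?_
  have hzμ := hz μ
  simp only [aliasPt] at hzμ ⊢
  by_cases hk : k μ = 0
  · rw [if_pos hk, mul_one]
    have : p μ + 2 * π * (k μ : ℝ) = p μ := by rw [hk]; push_cast; ring
    rw [this] at hzμ ⊢
    exact norm_uFac_le_half_pi hη hzμ
  · rw [if_neg hk]
    exact norm_uFac_alias_le hη (hp μ) hk hzμ

/-- `‖u^η(q)‖ ≤ (π/2)^d` on the zone `|ηq_μ| ≤ π`. [cite: King1986, (4.20) p.672] -/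
theorem norm_uWeight_le {d : ℕ} {η : ℝ} (hη : 0 < η) {q : Fin d → ℝ} (hz : ∀ μ, |η * q μ| ≤ π) :
    ‖uWeight η q‖ ≤ (π / 2) ^ d := by
  rw [norm_uWeight]
  have hconst : (π / 2) ^ d = ∏ _μ : Fin d, (π / 2 : ℝ) := by
    rw [Finset.prod_const, Finset.card_univ, Fintype.card_fin]
  rw [hconst]
  exact Finset.prod_le_prod (fun μ _ => norm_nonneg _) fun μ _ => norm_uFac_le_half_pi hη (hz μ)

/-- The sup norm of a momentum vector is dominated by its Euclidean size: `‖q‖² ≤ Σ_μ q_μ²`. [folklore] -/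
private theorem norm_sq_le_momSq {d : ℕ} (q : Fin d → ℝ) : ‖q‖ ^ 2 ≤ momSq q := by
  have h : ‖q‖ ≤ Real.sqrt (momSq q) := by
    refine (pi_norm_le_iff_of_nonneg (Real.sqrt_nonneg _)).mpr fun μ => ?_
    rw [Real.norm_eq_abs, ← Real.sqrt_sq_eq_abs]
    exact Real.sqrt_le_sqrt (Finset.single_le_sum (f := fun ν => q ν ^ 2) (fun ν _ => sq_nonneg (q ν))
      (Finset.mem_univ μ))
  calc ‖q‖ ^ 2 ≤ Real.sqrt (momSq q) ^ 2 := by gcongr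
    _ = momSq q := Real.sq_sqrt (momSq_nonneg q)

/-- The lattice symbol (4.4) is nonnegative for `m² ≥ 0`. [cite: King1986, (4.4) p.670] -/
theorem latticeSymbol_nonneg {d : ℕ} (η : ℝ) {M : ℝ} (hM : 0 ≤ M) (q : Fin d → ℝ) :
    0 ≤ latticeSymbol η M q := by
  unfold latticeSymbol
  exact add_nonneg (Finset.sum_nonneg fun μ _ => fdSymbol_nonneg η (q μ)) hM

/-- **(4.21), denominator**: on the zone, `Δ^η(q)⁻¹ ≤ (π²/4)·‖q‖^{−2}` for `q ≠ 0`, any mass `M ≥ 0`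
(Jordan's inequality `Δ^η(q) ≥ (4/π²)|q|² + M`). [cite: King1986, (4.21) p.672] -/
theorem inv_latticeSymbol_le {d : ℕ} {η : ℝ} (hη : η ≠ 0) {M : ℝ} (hM : 0 ≤ M) {q : Fin d → ℝ}
    (hz : ∀ μ, |η * q μ| ≤ π) (hq : 0 < ‖q‖) :
    (latticeSymbol η M q)⁻¹ ≤ π ^ 2 / 4 * ‖q‖ ^ (-2 : ℝ) := by
  have hj := latticeSymbol_ge_jordan hη M hz
  have h1 : 4 / π ^ 2 * ‖q‖ ^ 2 ≤ latticeSymbol η M q := by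
    have := norm_sq_le_momSq q
    nlinarith [div_pos (by norm_num : (0:ℝ) < 4) (pow_pos Real.pi_pos 2)]
  have hpos : 0 < 4 / π ^ 2 * ‖q‖ ^ 2 := by positivity
  rw [Real.rpow_neg (le_of_lt hq), show (2 : ℝ) = ((2 : ℕ) : ℝ) by norm_num, Real.rpow_natCast]
  calc (latticeSymbol η M q)⁻¹ ≤ (4 / π ^ 2 * ‖q‖ ^ 2)⁻¹ := by
        exact inv_anti₀ hpos h1
    _ = π ^ 2 / 4 * (‖q‖ ^ 2)⁻¹ := by
        field_simp

/-! ## §2 The modes of (4.2)/(4.19) and the far aliases `m ≠ 0` — (4.23) -/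

/-- The plane-wave factor `e^{iq·ξ}` of a mode (`ξ` = position in unit-lattice coordinates). [cite: King1986, (4.2) p.670] -/
def modePhase {d : ℕ} (q ξ : Fin d → ℝ) : ℂ :=
  Complex.exp (Complex.I * ((∑ μ, q μ * ξ μ : ℝ) : ℂ))

/-- The plane waves of (4.1)/(4.2) are unimodular: `‖e^{iq·ξ}‖ = 1`. [cite: King1986, (4.1)–(4.2) p.670] -/
theorem norm_modePhase {d : ℕ} (q ξ : Fin d → ℝ) : ‖modePhase q ξ‖ = 1 := by
  unfold modePhase
  exact Complex.norm_exp_I_mul_ofReal _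

/-- ONE MODE of the Fourier representation (4.2)/(4.19) of the minimiser kernel `a_kG_kQ_k^*` at the alias momentum
`q = p′ + l`: `Δ^{(k)}(p′) · u^η(q) · Δ^η(q)⁻¹ · e^{iq·ξ}` — here with the effective symbol `Δ` a free real parameter,
`η` the lattice spacing, `M` the mass term, `ξ` the position. [cite: King1986, (4.2) p.670, (4.19) p.672] -/
def modeTerm {d : ℕ} (Δ η M : ℝ) (q ξ : Fin d → ℝ) : ℂ :=
  ((Δ * (latticeSymbol η M q)⁻¹ : ℝ) : ℂ) * uWeight η q * modePhase q ξ

/-- The size of one mode: `Δ · Δ^η(q)⁻¹ · ‖u^η(q)‖`. [cite: King1986, (4.20)–(4.21) p.672] -/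
def modeAmp {d : ℕ} (Δ η M : ℝ) (q : Fin d → ℝ) : ℝ :=
  Δ * (latticeSymbol η M q)⁻¹ * ‖uWeight η q‖

/-- The size of one mode: `‖Δ·u^η(q)·Δ^η(q)⁻¹·e^{iq·ξ}‖ = Δ·Δ^η(q)⁻¹·‖u^η(q)‖` for `Δ ≥ 0`, `m² ≥ 0`. [cite: King1986, (4.20)–(4.21) p.672] -/
theorem norm_modeTerm {d : ℕ} {Δ η M : ℝ} (hΔ : 0 ≤ Δ) (hM : 0 ≤ M) (q ξ : Fin d → ℝ) :
    ‖modeTerm Δ η M q ξ‖ = modeAmp Δ η M q := by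
  unfold modeTerm modeAmp
  rw [norm_mul, norm_mul, norm_modePhase, mul_one, Complex.norm_real, Real.norm_eq_abs,
    abs_of_nonneg (mul_nonneg hΔ (inv_nonneg.mpr (latticeSymbol_nonneg η hM q)))]

/-- The size of a mode is nonnegative (`Δ ≥ 0`, `m² ≥ 0`). [cite: King1986, (4.20)–(4.21) p.672] -/
theorem modeAmp_nonneg {d : ℕ} {Δ η M : ℝ} (hΔ : 0 ≤ Δ) (hM : 0 ≤ M) (q : Fin d → ℝ) :
    0 ≤ modeAmp Δ η M q :=
  mul_nonneg (mul_nonneg hΔ (inv_nonneg.mpr (latticeSymbol_nonneg η hM q))) (norm_nonneg _)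

/-- The basic amplitude bound at a NONZERO alias: `Δ·Δ^η(q)⁻¹·‖u^η(q)‖ ≤ Δ·(π²/4)‖q‖^{−2}·(π/2)^d·aliasWeight`
((4.20) × (4.21)). [cite: King1986, (4.20)–(4.21) p.672] -/
theorem modeAmp_alias_le {d : ℕ} {η : ℝ} (hη : 0 < η) {M Δ : ℝ} (hM : 0 ≤ M) (hΔ : 0 ≤ Δ)
    {p : Fin d → ℝ} (hp : ∀ μ, |p μ| ≤ π) {k : Fin d → ℤ} (hk : k ≠ 0)
    (hz : ∀ μ, |η * aliasPt p k μ| ≤ π) :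
    modeAmp Δ η M (aliasPt p k)
      ≤ Δ * (π ^ 2 / 4 * ‖aliasPt p k‖ ^ (-2 : ℝ)) * ((π / 2) ^ d * aliasWeight p k) := by
  have hq1 : 1 ≤ ‖aliasPt p k‖ := one_le_norm_aliasPt hp hk
  have hqpos : 0 < ‖aliasPt p k‖ := lt_of_lt_of_le one_pos hq1
  unfold modeAmp
  refine mul_le_mul (mul_le_mul_of_nonneg_left (inv_latticeSymbol_le (ne_of_gt hη) hM hz hqpos) hΔ)
    (norm_uWeight_alias_le hη hp k hz) (norm_nonneg _) ?_
  exact mul_nonneg hΔ (by positivity)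

/-- **THE FAR ALIASES, termwise** ((4.23)): if the alias point is at sup-distance `≥ N` from the origin (King: the
`m ≠ 0` aliases of the finer lattice, `|p′+l+m| ≥ πL^k`), then for `0 ≤ γ`
`Δ·Δ^{η′}(q)⁻¹·‖u^{η′}(q)‖ ≤ a·(π/2)^d(π²/4)·N^{−γ}·(‖q‖^{γ−2}·aliasWeight)` — the rate `N^{−γ}` is traded against `γ`
powers of the alias momentum. [cite: King1986, (4.23) p.672] -/
theorem modeAmp_far_le {d : ℕ} {η : ℝ} (hη : 0 < η) {M Δ a : ℝ} (hM : 0 ≤ M) (hΔ : 0 ≤ Δ) (hΔa : Δ ≤ a)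
    {γ : ℝ} (hγ : 0 ≤ γ) {N : ℝ} (hN : 1 ≤ N)
    {p : Fin d → ℝ} (hp : ∀ μ, |p μ| ≤ π) {k : Fin d → ℤ} (hk : k ≠ 0)
    (hz : ∀ μ, |η * aliasPt p k μ| ≤ π) (hfar : N ≤ ‖aliasPt p k‖) :
    modeAmp Δ η M (aliasPt p k)
      ≤ a * ((π / 2) ^ d * (π ^ 2 / 4)) * N ^ (-γ) * aliasTerm (γ - 1) p k := by
  have hNpos : 0 < N := lt_of_lt_of_le one_pos hN
  have hqpos : 0 < ‖aliasPt p k‖ := lt_of_lt_of_le hNpos hfar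
  have h1 := modeAmp_alias_le hη hM hΔ hp hk hz
  -- the trade `‖q‖^{-2} = ‖q‖^{-γ} ‖q‖^{γ-2} ≤ N^{-γ} ‖q‖^{γ-2}`
  have htrade : ‖aliasPt p k‖ ^ (-2 : ℝ) ≤ N ^ (-γ) * ‖aliasPt p k‖ ^ (γ - 1 - 1) := by
    have hsplit : ‖aliasPt p k‖ ^ (-2 : ℝ) = ‖aliasPt p k‖ ^ (-γ) * ‖aliasPt p k‖ ^ (γ - 1 - 1) := by
      rw [← Real.rpow_add hqpos]; congr 1; ring
    rw [hsplit]
    refine mul_le_mul_of_nonneg_right ?_ (Real.rpow_nonneg (le_of_lt hqpos) _)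
    rw [Real.rpow_neg (le_of_lt hqpos), Real.rpow_neg (le_of_lt hNpos)]
    exact inv_anti₀ (Real.rpow_pos_of_pos hNpos γ) (Real.rpow_le_rpow (le_of_lt hNpos) hfar hγ)
  have hW : 0 ≤ aliasWeight p k := by
    unfold aliasWeight
    exact Finset.prod_nonneg fun μ _ => by split_ifs <;> positivity
  have ha : 0 ≤ a := hΔ.trans hΔa
  unfold aliasTerm
  calc modeAmp Δ η M (aliasPt p k)
      ≤ Δ * (π ^ 2 / 4 * ‖aliasPt p k‖ ^ (-2 : ℝ)) * ((π / 2) ^ d * aliasWeight p k) := h1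
    _ ≤ a * (π ^ 2 / 4 * (N ^ (-γ) * ‖aliasPt p k‖ ^ (γ - 1 - 1))) * ((π / 2) ^ d * aliasWeight p k) := by
        gcongr
    _ = a * ((π / 2) ^ d * (π ^ 2 / 4)) * N ^ (-γ) * (‖aliasPt p k‖ ^ (γ - 1 - 1) * aliasWeight p k) := by
        ring

/-- **(4.23) summed**: over any finite family `Λ` of nonzero aliases, each at sup-distance `≥ N` from the origin and in
the zone of `η′`, `Σ_{k∈Λ} Δ·Δ^{η′}(q_k)⁻¹‖u^{η′}(q_k)‖ ≤ a(π/2)^d(π²/4)·C(d, γ−1)·N^{−γ}` for `0 ≤ γ < 2`, `d ≥ 1` —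
King's "≤ CL^{−γk}" for the `m ≠ 0` part of (4.19), with `C(d, ·) = aliasConst` of (4.22). [cite: King1986, (4.22)–(4.23) p.672] -/
theorem sum_modeAmp_far_le {d : ℕ} (hd : 0 < d) {η : ℝ} (hη : 0 < η) {M Δ a : ℝ} (hM : 0 ≤ M) (hΔ : 0 ≤ Δ)
    (hΔa : Δ ≤ a) {γ : ℝ} (hγ : 0 ≤ γ) (hγ2 : γ < 2) {N : ℝ} (hN : 1 ≤ N)
    {p : Fin d → ℝ} (hp : ∀ μ, |p μ| ≤ π) {Λ : Finset (Fin d → ℤ)} (h0 : (0 : Fin d → ℤ) ∉ Λ)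
    (hz : ∀ k ∈ Λ, ∀ μ, |η * aliasPt p k μ| ≤ π) (hfar : ∀ k ∈ Λ, N ≤ ‖aliasPt p k‖) :
    ∑ k ∈ Λ, modeAmp Δ η M (aliasPt p k)
      ≤ a * ((π / 2) ^ d * (π ^ 2 / 4)) * N ^ (-γ) * aliasConst d (γ - 1) := by
  have ha : 0 ≤ a := hΔ.trans hΔa
  have hNpos : 0 < N := lt_of_lt_of_le one_pos hN
  calc ∑ k ∈ Λ, modeAmp Δ η M (aliasPt p k)
      ≤ ∑ k ∈ Λ, a * ((π / 2) ^ d * (π ^ 2 / 4)) * N ^ (-γ) * aliasTerm (γ - 1) p k := by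
        refine Finset.sum_le_sum fun k hk => ?_
        have hk0 : k ≠ 0 := fun h => h0 (h ▸ hk)
        exact modeAmp_far_le hη hM hΔ hΔa hγ hN hp hk0 (hz k hk) (hfar k hk)
    _ = a * ((π / 2) ^ d * (π ^ 2 / 4)) * N ^ (-γ) * ∑ k ∈ Λ, aliasTerm (γ - 1) p k := by
        rw [Finset.mul_sum]
    _ ≤ a * ((π / 2) ^ d * (π ^ 2 / 4)) * N ^ (-γ) * aliasConst d (γ - 1) := by
        refine mul_le_mul_of_nonneg_left (alias_sum_le_of_subset hd (by linarith) hp h0) ?_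
        exact mul_nonneg (mul_nonneg ha (by positivity)) (Real.rpow_nonneg (le_of_lt hNpos) _)

/-! ## §3 The constants of Proposition 3.8's momentum-space bound (used by the sequel `MinimizerAliasRate`) -/

/-- The constant in front of `N^{−γ} = L^{−γk}` for one near alias: `a·(π/2)^d·[(π²/4)θ + (π²/24)π^{2−γ} +
(π²/4)((π/2)^{d+1}+1)d^γ]` — the three replacement errors Lemma 4.3 (`θ`), (4.31), Lemma 4.4. [cite: King1986, p.673] -/
def nearRateConst (aA θ : ℝ) (d : ℕ) (γ : ℝ) : ℝ :=
  aA * (π / 2) ^ d * (π ^ 2 / 4 * θ + π ^ 2 / 24 * π ^ (2 - γ) + π ^ 2 / 4 * ((π / 2) ^ (d + 1) + 1) * (d : ℝ) ^ γ)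

/-- The constant in front of `|x − x′|^γ` for one near alias: `2a(π/2)^d(π²/4)d^γ` — the phase replacement (4.24).
[cite: King1986, (4.24) p.673] -/
def nearPosConst (aA : ℝ) (d : ℕ) (γ : ℝ) : ℝ :=
  aA * (π / 2) ^ d * (π ^ 2 / 4) * 2 * (d : ℝ) ^ γ

/-- Rate constant of the central alias: `(π/2)^d·[θK(π²/4) + a(π²/24) + K((π/2)^{d+1}+1)(dπ)^γ]`.
[cite: King1986, p.673] -/
def centralRateConst (aA θ K : ℝ) (d : ℕ) (γ : ℝ) : ℝ :=
  (π / 2) ^ d * (θ * K * (π ^ 2 / 4) + aA * (π ^ 2 / 24) + K * (π ^ 2 / 4) * ((π / 2) ^ (d + 1) + 1) * ((d : ℝ) * π) ^ γ)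

/-- Position constant of the central alias: `2K(π/2)^d(dπ)^γ`. [cite: King1986, (4.24) p.673] -/
def centralPosConst (K : ℝ) (d : ℕ) (γ : ℝ) : ℝ :=
  2 * K * (π / 2) ^ d * ((d : ℝ) * π) ^ γ

/-- Rate constant of the assembled bound: far part + near part × `C(d,γ−1)` + central part.
[cite: King1986, Prop. 3.8 p.664 with (4.22)–(4.31) pp.672–673] -/
def prop38RateConst (aA aB θ K : ℝ) (d : ℕ) (γ : ℝ) : ℝ :=
  aB * ((π / 2) ^ d * (π ^ 2 / 4)) * aliasConst d (γ - 1) + nearRateConst aA θ d γ * aliasConst d (γ - 1)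
    + centralRateConst aA θ K d γ

/-- Position constant of the assembled bound: near part × `C(d,γ−1)` + central part.
[cite: King1986, Prop. 3.8 p.664 with (4.24) p.673] -/
def prop38PosConst (aA K : ℝ) (d : ℕ) (γ : ℝ) : ℝ :=
  nearPosConst aA d γ * aliasConst d (γ - 1) + centralPosConst K d γ

/-- The constant `θ` of Lemma 4.3 in the relative form `|Δ^{(k+n)} − Δ^{(k)}| ≤ θ·L^{−2k}·Δ^{(k)}`:
`θ = 2a_k(a_n⁻¹ + π²/48 + 1/3)` (`lemma43_aK`). [cite: King1986, Lemma 4.3 (4.18) p.672] -/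
def lemma43Const (a : ℝ) (L : ℕ) (k n : ℕ) : ℝ :=
  aK a L k * (2 * ((aK a L n)⁻¹ + π ^ 2 / 48 + 1 / 3))

/-- The Lemma 4.3 constant `2a_k(a_n⁻¹ + π²/48 + 1/3)` is nonnegative (`a_k, a_n > 0`). [cite: King1986, Lemma 4.3 (4.18) p.672, (2.13) p.653] -/
theorem lemma43Const_nonneg {a : ℝ} (ha : 0 < a) {L : ℕ} (hL : 2 ≤ L) {k n : ℕ} (hk : 1 ≤ k) (hn : 1 ≤ n) :
    0 ≤ lemma43Const a L k n := by
  have hLr : (1 : ℝ) < L := by exact_mod_cast (lt_of_lt_of_le one_lt_two hL)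
  have h1 := aK_pos ha hLr hk
  have h2 := aK_pos ha hLr hn
  unfold lemma43Const; positivity

end Literature.MathematicalPhysics.QuantumFieldTheory.King1986
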